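import Summits.RiemannHypothesis.RiemannHypothesis.Theorems.SoloInformedJumpingCells
import Summits.RiemannHypothesis.RiemannHypothesis.Theorems.SoloInformedDoubleLogLaw
import HarnessLib

/-!
# RH ⟹ no comb pocket at any height (E1, soloist)

Sorry-free.  Corollary E1 of Lemma 2k.E (soloist's `paper/sharpest.md` §2k (xi)): under RH the
ordinates of the zeros of `ζ` in a window of radius `R` around ANY height `h ≥ 2R` cannot all lie
within `u ≍ 1/τ` of a lattice `h + (π/τ)ℤ`, as soon as `R ≥ e^{Aτ}`.

**Theorem** (`exists_zero_off_comb_of_riemannHypothesis`).  Assume RH.  There is `A > 0` such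
that for all `τ ≥ 1`, `R ≥ exp(A τ)`, `h ≥ 2R` and `0 ≤ u ≤ 1/(A τ)` some zero
`ζ(1/2 + iγ) = 0` with `|γ − h| ≤ R` satisfies `|γ − h − kπ/τ| > u` for every `k ∈ ℤ`.

Compare T71 (`exists_zero_off_comb_of_log_height`, hypothesis-free geometric side): there the
exclusion needs `log h ≥ A·a·e^{a}` (Littlewood's threshold) and a tolerance
`u² ≲ 1/(A a³ (1+R²))`; here the height is arbitrary (`h ≥ 2R`) and the tolerance is a constant
fraction of the lattice spacing, at the price `R ≥ e^{Aτ}` (the cell scale `b ≍ τ` of Lemma 2k.E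
must satisfy `b ≤ (log R)/4`).  Proof: by `jumping_cells_of_riemannHypothesis` the window
`[h − R, h]` has `≥ c b R` cells of width `1/b` on which `N` jumps, `b = Bτ`; each holds an
ordinate, hence (pocket) an integer `k` with `|γ − h − kπ/τ| ≤ u`; cells with the same `k` are
`≤ 2ub + 2 ≤ 3` in number and `|k| ≤ Rτ`, so `c B τ R ≤ (5/2)(2Rτ + 3)`, false for `cB = 16 + c`.
-/

noncomputable section

open Real Complex MeasureTheory Set Filter Literature.NumberTheory.LFunctions

namespace Summit.RiemannHypothesis.RiemannHypothesis.Theorems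

/-- A finite set of naturals of diameter `≤ D` has at most `D + 1` elements. -/
theorem card_le_of_forall_le_add {s : Finset ℕ} {D : ℕ} (h : ∀ x ∈ s, ∀ y ∈ s, x ≤ y + D) :
    s.card ≤ D + 1 := by
  rcases s.eq_empty_or_nonempty with rfl | hs
  · simp
  have hsub : s ⊆ Finset.Icc (s.min' hs) (s.min' hs + D) := fun x hx ↦
    Finset.mem_Icc.2 ⟨Finset.min'_le s x hx, h x hx _ (Finset.min'_mem s hs)⟩
  refine (Finset.card_le_card hsub).trans ?_
  rw [Nat.card_Icc]
  omega

/-- The number of integers `k` with `|k| ≤ K`, as a real number: `#Icc (−K) K ≤ 2X + 3` if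
`K = ⌈X⌉`, `X ≥ 0`. -/
theorem card_Icc_neg_ceil_le {X : ℝ} (hX : 0 ≤ X) :
    ((Finset.Icc (-⌈X⌉) ⌈X⌉).card : ℝ) ≤ 2 * X + 3 := by
  have hK0 : (0 : ℝ) ≤ (⌈X⌉ : ℝ) := hX.trans (Int.le_ceil _)
  have hKle : (⌈X⌉ : ℝ) < X + 1 := Int.ceil_lt_add_one _
  have h0 : (0 : ℤ) ≤ ⌈X⌉ := by exact_mod_cast hK0
  have e : (((Finset.Icc (-⌈X⌉) ⌈X⌉).card : ℕ) : ℤ) = 2 * ⌈X⌉ + 1 := by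
    rw [Int.card_Icc, Int.toNat_of_nonneg (by omega)]
    ring
  have e' : (((Finset.Icc (-⌈X⌉) ⌈X⌉).card : ℕ) : ℝ) = 2 * (⌈X⌉ : ℝ) + 1 := by
    exact_mod_cast e
  rw [e']
  linarith

set_option maxHeartbeats 400000 in
/-- **RH ⟹ no comb pocket at any height.**  See the module docstring. -/
theorem exists_zero_off_comb_of_riemannHypothesis (hRH : _root_.RiemannHypothesis) :
    ∃ A : ℝ, 0 < A ∧ ∀ τ h R u : ℝ, 1 ≤ τ → Real.exp (A * τ) ≤ R → 2 * R ≤ h → 0 ≤ u →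
      u * (A * τ) ≤ 1 →
      ∃ γ : ℝ, riemannZeta (1 / 2 + γ * I) = 0 ∧ |γ - h| ≤ R ∧
        ∀ k : ℤ, u < |γ - h - k * π / τ| := by
  obtain ⟨Φ, μ, hΦ, ha, hμ0, hμ⟩ := exists_isWeilTest_mellin_floor
  obtain ⟨c, tstar, V₀, hc, hcell⟩ := jumping_cells_of_riemannHypothesis hRH hΦ ha hμ0 hμ
  obtain ⟨B, hB⟩ : ∃ B : ℝ, B = 16 / c + 1 := ⟨_, rfl⟩
  have hB1 : 1 ≤ B := by rw [hB]; linarith [div_pos (by norm_num : (0 : ℝ) < 16) hc]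
  have hcB : c * B = 16 + c := by rw [hB]; field_simp
  obtain ⟨A, hA⟩ : ∃ A : ℝ, A = 4 * B + |V₀| + |tstar| + 1 := ⟨_, rfl⟩
  have hA1 : 1 ≤ A := by rw [hA]; linarith [abs_nonneg V₀, abs_nonneg tstar]
  refine ⟨A, by linarith, fun τ h R u hτ hR hh hu0 hu ↦ ?_⟩
  -- sizes
  have hAτ : A ≤ A * τ := le_mul_of_one_le_right (by linarith) hτ
  have hRA : A ≤ R := by linarith [Real.add_one_le_exp (A * τ)]
  have hR1 : 1 ≤ R := hA1.trans hRA
  have hRV : V₀ ≤ R := by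
    rw [hA] at hRA; linarith [le_abs_self V₀, abs_nonneg tstar]
  have hRt : tstar ≤ h - R := by
    rw [hA] at hRA; linarith [le_abs_self tstar, abs_nonneg V₀]
  have hτ0 : 0 < τ := by linarith
  have hτR : 1 ≤ τ * R := one_le_mul_of_one_le_of_one_le hτ hR1
  -- the cell scale `b = B τ`
  obtain ⟨b, hb⟩ : ∃ b : ℝ, b = B * τ := ⟨_, rfl⟩
  have hb1 : 1 ≤ b := hb ▸ one_le_mul_of_one_le_of_one_le hB1 hτ
  have hb0 : 0 < b := by linarith
  have hbA : 4 * b ≤ A * τ := by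
    rw [hb, hA]
    nlinarith [abs_nonneg V₀, abs_nonneg tstar]
  have hb4 : 4 * b ≤ Real.log R :=
    hbA.trans ((Real.le_log_iff_exp_le (by linarith)).2 hR)
  have hub : 2 * u * b ≤ 1 / 2 := by nlinarith
  -- the jumping cells of the window `[h − R, h]`
  obtain ⟨Occ, hOcc⟩ : ∃ Occ : Finset ℕ, Occ = (Finset.range ⌊b * R⌋₊).filter (fun j : ℕ ↦
      (zetaZeroCount (h - R + (j : ℝ) / b) : ℝ) <
        zetaZeroCount (h - R + ((j : ℝ) + 1) / b)) := ⟨_, rfl⟩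
  have hcnt : c * b * R ≤ Occ.card := by
    rw [hOcc]; exact hcell (h - R) R b hRt hRV (by linarith) hb1 hb4
  by_contra hno
  push Not at hno
  -- a zero in every jumping cell, inside the pocket
  have hzero : ∀ j ∈ Occ, ∃ γ : ℝ, h - R + j / b < γ ∧ γ ≤ h - R + ((j : ℝ) + 1) / b ∧
      riemannZeta (1 / 2 + γ * I) = 0 := by
    intro j hj
    rw [hOcc, Finset.mem_filter] at hj
    exact exists_ordinate_of_zetaZeroCount_lt hRH (by exact_mod_cast hj.2)
  choose! γ hγ1 hγ2 hγ3 using hzero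
  have hjR : ∀ j ∈ Occ, ((j : ℝ) + 1) / b ≤ R := by
    intro j hj
    rw [hOcc, Finset.mem_filter, Finset.mem_range] at hj
    have h1 : ((j : ℝ) + 1) ≤ ⌊b * R⌋₊ := by exact_mod_cast Nat.succ_le_of_lt hj.1
    rw [div_le_iff₀ hb0]
    linarith [Nat.floor_le (by positivity : 0 ≤ b * R)]
  have habs : ∀ j ∈ Occ, |γ j - h| ≤ R := by
    intro j hj
    have h0 : (0 : ℝ) ≤ j / b := by positivity
    rw [abs_le]
    exact ⟨by linarith [hγ1 j hj], by linarith [hγ2 j hj, hjR j hj]⟩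
  have hk : ∀ j ∈ Occ, ∃ k : ℤ, |γ j - h - k * π / τ| ≤ u := fun j hj ↦
    hno (γ j) (hγ3 j hj) (habs j hj)
  choose! kk hkk using hk
  -- the range of `k`
  have hmaps : ∀ j ∈ Occ, kk j ∈ Finset.Icc (-⌈R * τ⌉) ⌈R * τ⌉ := by
    intro j hj
    have h1 : |(kk j : ℝ) * π / τ| ≤ R + 1 := by
      have e : (kk j : ℝ) * π / τ = (γ j - h) - (γ j - h - kk j * π / τ) := by ring
      rw [e]
      exact (abs_sub _ _).trans (by linarith [habs j hj, hkk j hj, (by nlinarith : u ≤ 1)])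
    rw [abs_div, abs_mul, abs_of_pos Real.pi_pos, abs_of_pos hτ0, div_le_iff₀ hτ0] at h1
    have h2 : |(kk j : ℝ)| ≤ R * τ := by
      have h3 : |(kk j : ℝ)| * π ≤ π * (R * τ) := by
        nlinarith [Real.pi_gt_three, abs_nonneg (kk j : ℝ)]
      nlinarith [Real.pi_pos, abs_nonneg (kk j : ℝ)]
    have h4 : |(kk j : ℝ)| ≤ ⌈R * τ⌉ := h2.trans (Int.le_ceil _)
    have h5 : |kk j| ≤ ⌈R * τ⌉ := by exact_mod_cast h4
    exact Finset.mem_Icc.2 (abs_le.1 h5)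
  -- cells with the same `k`
  obtain ⟨D, hD⟩ : ∃ D : ℕ, D = ⌊2 * u * b + 1⌋₊ := ⟨_, rfl⟩
  have hD1 : (D : ℝ) ≤ 2 * u * b + 1 := by rw [hD]; exact Nat.floor_le (by positivity)
  have hDlt : 2 * u * b + 1 < (D : ℝ) + 1 := by rw [hD]; exact Nat.lt_floor_add_one _
  have hfib : ∀ k ∈ Finset.Icc (-⌈R * τ⌉) ⌈R * τ⌉,
      (Occ.filter (fun j : ℕ ↦ kk j = k)).card ≤ D + 1 := by
    intro k _
    refine card_le_of_forall_le_add fun x hx y hy ↦ ?_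
    rw [Finset.mem_filter] at hx hy
    have h1 : |γ x - γ y| ≤ u + u := by
      have e : γ x - γ y = (γ x - h - kk x * π / τ) - (γ y - h - kk y * π / τ) := by
        rw [hx.2, hy.2]; ring
      rw [e]
      exact (abs_sub _ _).trans (add_le_add (hkk x hx.1) (hkk y hy.1))
    have h2 : ((x : ℝ) - y - 1) / b < 2 * u := by
      have h3 : γ x - γ y ≤ 2 * u := by linarith [le_abs_self (γ x - γ y)]
      have e : ((x : ℝ) - y - 1) / b = x / b - ((y : ℝ) + 1) / b := by ring
      rw [e]
      linarith [hγ1 x hx.1, hγ2 y hy.1]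
    rw [div_lt_iff₀ hb0] at h2
    have h4 : (x : ℝ) < y + ((D : ℝ) + 1) := by linarith
    have h5 : x < y + (D + 1) := by exact_mod_cast h4
    omega
  have hcard := Finset.card_le_mul_card_image_of_maps_to hmaps (D + 1) hfib
  -- the contradiction
  have hup : (Occ.card : ℝ) ≤ ((D : ℝ) + 1) * (2 * (R * τ) + 3) := by
    have h1 : (Occ.card : ℝ) ≤
        ((D + 1 : ℕ) : ℝ) * ((Finset.Icc (-⌈R * τ⌉) ⌈R * τ⌉).card : ℝ) := by
      exact_mod_cast hcard
    push_cast at h1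
    exact h1.trans (mul_le_mul_of_nonneg_left (card_Icc_neg_ceil_le (by positivity))
      (by positivity))
  have hlow : (16 + c) * (τ * R) ≤ Occ.card := by
    calc (16 + c) * (τ * R) = c * b * R := by rw [← hcB, hb]; ring
      _ ≤ _ := hcnt
  have hD2 : (D : ℝ) + 1 ≤ 5 / 2 := by linarith
  have h6 : ((D : ℝ) + 1) * (2 * (R * τ) + 3) ≤ 5 / 2 * (5 * (τ * R)) :=
    mul_le_mul hD2 (by nlinarith) (by positivity) (by norm_num)
  nlinarith [mul_pos hc (by linarith : (0 : ℝ) < τ * R)]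

end Summit.RiemannHypothesis.RiemannHypothesis.Theorems

end
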